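import Literature.Probability.RandomPlanarGeometry.SAWCount
import HarnessLib

/-!
# Half-space self-avoiding pieces `0 → ±e_j` from walks closing next to the origin (`ℤ^d`, every `d`)

Topic `Literature/Probability/RandomPlanarGeometry` (continues `SAWCount.lean`: `Zd.sawFun`, `Zd.countAt`; general-`d` twin of
`SAWHalfPlanePieces.lean`).

Source: N. Madras, G. Slade, *The Self-Avoiding Walk* (1993), §3.2: eq. (3.2.1) (an `N`-step self-avoiding polygon through a
fixed bond is an `(N−1)`-step self-avoiding walk closing next to the origin, and conversely), eqs. (3.2.3)–(3.2.4) (re-rooting a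
polygon at an extreme vertex: the classes `Q_i[N]`), and the proof of Corollary 3.2.6 (the re-rooted polygon, opened at the
extreme vertex, lies in a half-space).  In the vertex-function vocabulary of the tree: an `m`-step self-avoiding walk `ω : 0 → e`
(`e` a neighbour of the origin) together with the bond `{e, 0}` is a closed self-avoiding loop; re-rooting it at a vertex `a`
extreme in the direction `−s e_k` and opening it at `a` produces an `m`-step self-avoiding walk `a → a + τ e_j` with `j ≠ k` all of
whose vertices satisfy `s · (y − a)_k ≥ 0` (one of the two loop-neighbours of `a` is not `a + s e_k`).  Counting the `m + 1` roots,
the two readings and the directions `τ e_j`: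

* **`countAt_le_sum_card_halfSpace`**: for `m ≥ 2`, a sign `s` and a neighbour `e` of `0`,
  `c_m(0, e) ≤ 2 (m+1) · Σ_{j ≠ k, τ = ±1} #{η ∈ sawFun d m (τ e_j) : ∀ i ≤ m, 0 ≤ s η(i)_k}`.

These half-space pieces are the objects inserted into long walks in `SAWEndpointPieceInsertionZd.lean`.
-/

noncomputable section

open Finset Literature.Probability.LatticeModels SimpleGraph

namespace Literature.Probability.RandomPlanarGeometry.SAW.Zd

namespace HalfSpacePieces

variable {d : ℕ}

/-! ### Re-rooting a closed loop: index arithmetic without `%` -/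

/-- Forward cyclic index `i₀ + l (mod m+1)` for `i₀, l ≤ m`. [folklore] -/
def idxF (m i₀ l : ℕ) : ℕ := if i₀ + l ≤ m then i₀ + l else i₀ + l - (m + 1)

/-- Backward cyclic index `i₀ − l (mod m+1)` for `i₀, l ≤ m`. [folklore] -/
def idxB (m i₀ l : ℕ) : ℕ := if l ≤ i₀ then i₀ - l else i₀ + (m + 1) - l

/-- The loop `ω(0), …, ω(m), ω(0)` re-rooted at `ω(i₀)`, read forward, translated to start at `0`.
[cite: MadrasSlade1993, §3.2, eqs. (3.2.1), (3.2.3)–(3.2.4) (re-rooting a polygon)] -/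
def rerootF (m i₀ : ℕ) (ω : ℕ → Site d) : ℕ → Site d := fun l => ω (idxF m i₀ (min l m)) - ω i₀

/-- The loop re-rooted at `ω(i₀)`, read backward, translated to start at `0`.
[cite: MadrasSlade1993, §3.2, eqs. (3.2.1), (3.2.3)–(3.2.4) (re-rooting a polygon)] -/
def rerootB (m i₀ : ℕ) (ω : ℕ → Site d) : ℕ → Site d := fun l => ω (idxB m i₀ (min l m)) - ω i₀

/-- Inverse of the forward re-rooting (given the root index). [folklore] -/
def unrootF (m i₀ : ℕ) (π : ℕ → Site d) : ℕ → Site d := fun r =>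
  π (if i₀ ≤ min r m then min r m - i₀ else min r m + (m + 1) - i₀) - π (if i₀ = 0 then 0 else m + 1 - i₀)

/-- Inverse of the backward re-rooting (given the root index). [folklore] -/
def unrootB (m i₀ : ℕ) (π : ℕ → Site d) : ℕ → Site d := fun r =>
  π (if min r m ≤ i₀ then i₀ - min r m else i₀ + (m + 1) - min r m) - π i₀

variable {m i₀ : ℕ} {e : Site d} {ω : ℕ → Site d}

/-- `unrootF` inverts `rerootF` on walks `0 → e` frozen after time `m`. [folklore] -/
private theorem unrootF_rerootF (hω : ω ∈ sawFun d m e) (hi₀ : i₀ ≤ m) : unrootF m i₀ (rerootF m i₀ ω) = ω := by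
  obtain ⟨h0, hend, -, -⟩ := mem_sawFun.1 hω
  funext r
  have hr : ω r = ω (min r m) := by
    rcases le_or_gt r m with h | h
    · rw [min_eq_left h]
    · rw [min_eq_right h.le, hend r h.le, hend m le_rfl]
  rw [hr]
  set r' := min r m with hr'
  have hr'm : r' ≤ m := min_le_right _ _
  simp only [unrootF, rerootF]
  have e0 : idxF m i₀ (min (if i₀ = 0 then 0 else m + 1 - i₀) m) = 0 := by
    unfold idxF; split_ifs <;> omega
  have e1 : idxF m i₀ (min (if i₀ ≤ r' then r' - i₀ else r' + (m + 1) - i₀) m) = r' := by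
    unfold idxF; split_ifs <;> omega
  rw [e0, e1, h0]; abel

/-- `unrootB` inverts `rerootB` on walks `0 → e` frozen after time `m`. [folklore] -/
private theorem unrootB_rerootB (hω : ω ∈ sawFun d m e) (hi₀ : i₀ ≤ m) : unrootB m i₀ (rerootB m i₀ ω) = ω := by
  obtain ⟨h0, hend, -, -⟩ := mem_sawFun.1 hω
  funext r
  have hr : ω r = ω (min r m) := by
    rcases le_or_gt r m with h | h
    · rw [min_eq_left h]
    · rw [min_eq_right h.le, hend r h.le, hend m le_rfl]
  rw [hr]
  set r' := min r m with hr'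
  have hr'm : r' ≤ m := min_le_right _ _
  simp only [unrootB, rerootB]
  have e0 : idxB m i₀ (min i₀ m) = 0 := by
    unfold idxB; rw [min_eq_left hi₀]; simp
  have e1 : idxB m i₀ (min (if r' ≤ i₀ then i₀ - r' else i₀ + (m + 1) - r') m) = r' := by
    unfold idxB; split_ifs <;> omega
  rw [e0, e1, h0]; abel

/-! ### The re-rooted loop is a self-avoiding walk -/

/-- Cyclic adjacency of the closed loop `ω ∪ {e, 0}`. [cite: MadrasSlade1993, §3.2, eq. (3.2.1)] -/
private theorem adj_idxF (he : (zdGraph d).Adj 0 e) (hω : ω ∈ sawFun d m e) (hi₀ : i₀ ≤ m) {l : ℕ} (hl : l < m) :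
    (zdGraph d).Adj (ω (idxF m i₀ l)) (ω (idxF m i₀ (l + 1))) := by
  obtain ⟨h0, hend, hadj, -⟩ := mem_sawFun.1 hω
  unfold idxF
  rcases Nat.lt_trichotomy (i₀ + l) m with h | h | h
  · rw [if_pos h.le, if_pos (by omega), ← add_assoc]; exact hadj _ h
  · rw [if_pos h.le, if_neg (by omega), h, show i₀ + (l + 1) - (m + 1) = 0 by omega, hend m le_rfl, h0]
    exact he.symm
  · rw [if_neg (by omega), if_neg (by omega), show i₀ + (l + 1) - (m + 1) = i₀ + l - (m + 1) + 1 by omega]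
    exact hadj _ (by omega)

/-- Cyclic adjacency of the closed loop, backwards. [cite: MadrasSlade1993, §3.2, eq. (3.2.1)] -/
private theorem adj_idxB (he : (zdGraph d).Adj 0 e) (hω : ω ∈ sawFun d m e) (hi₀ : i₀ ≤ m) {l : ℕ} (hl : l < m) :
    (zdGraph d).Adj (ω (idxB m i₀ l)) (ω (idxB m i₀ (l + 1))) := by
  obtain ⟨h0, hend, hadj, -⟩ := mem_sawFun.1 hω
  unfold idxB
  rcases Nat.lt_trichotomy l i₀ with h | h | h
  · rw [if_pos h.le, if_pos (by omega)]
    have := hadj (i₀ - (l + 1)) (by omega)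
    rw [show i₀ - (l + 1) + 1 = i₀ - l by omega] at this
    exact this.symm
  · rw [if_pos h.le, if_neg (by omega), h, Nat.sub_self, h0, show i₀ + (m + 1) - (i₀ + 1) = m by omega, hend m le_rfl]
    exact he
  · rw [if_neg (by omega), if_neg (by omega)]
    have := hadj (i₀ + (m + 1) - (l + 1)) (by omega)
    rw [show i₀ + (m + 1) - (l + 1) + 1 = i₀ + (m + 1) - l by omega] at this
    exact this.symm

/-- The forward re-rooted loop is an `m`-step self-avoiding walk from `0` to `ω(i₀ − 1) − ω(i₀)` (cyclically).
[cite: MadrasSlade1993, §3.2, eqs. (3.2.1), (3.2.3)–(3.2.4)] -/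
private theorem rerootF_mem_sawFun (he : (zdGraph d).Adj 0 e) (hω : ω ∈ sawFun d m e) (hi₀ : i₀ ≤ m) :
    rerootF m i₀ ω ∈ sawFun d m (ω (idxF m i₀ m) - ω i₀) := by
  obtain ⟨h0, hend, hadj, hinj⟩ := mem_sawFun.1 hω
  refine mem_sawFun.2 ⟨?_, fun l hl => ?_, fun l hl => ?_, fun a ha b hb hab => ?_⟩
  · simp [rerootF, idxF, hi₀]
  · simp [rerootF, min_eq_right hl]
  · simp only [rerootF, min_eq_left hl.le, min_eq_left (Nat.succ_le_of_lt hl)]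
    rw [zdGraph_adj_sub_right]
    exact adj_idxF he hω hi₀ hl
  · simp only [Set.mem_setOf_eq] at ha hb
    simp only [rerootF, min_eq_left ha, min_eq_left hb, sub_left_inj] at hab
    have h1 : idxF m i₀ a ≤ m := by unfold idxF; split_ifs <;> omega
    have h2 : idxF m i₀ b ≤ m := by unfold idxF; split_ifs <;> omega
    have := hinj h1 h2 hab
    unfold idxF at this; split_ifs at this <;> omega

/-- The backward re-rooted loop is an `m`-step self-avoiding walk from `0` to `ω(i₀ + 1) − ω(i₀)` (cyclically).
[cite: MadrasSlade1993, §3.2, eqs. (3.2.1), (3.2.3)–(3.2.4)] -/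
private theorem rerootB_mem_sawFun (he : (zdGraph d).Adj 0 e) (hω : ω ∈ sawFun d m e) (hi₀ : i₀ ≤ m) :
    rerootB m i₀ ω ∈ sawFun d m (ω (idxB m i₀ m) - ω i₀) := by
  obtain ⟨h0, hend, hadj, hinj⟩ := mem_sawFun.1 hω
  refine mem_sawFun.2 ⟨?_, fun l hl => ?_, fun l hl => ?_, fun a ha b hb hab => ?_⟩
  · simp [rerootB, idxB]
  · simp [rerootB, min_eq_right hl]
  · simp only [rerootB, min_eq_left hl.le, min_eq_left (Nat.succ_le_of_lt hl)]
    rw [zdGraph_adj_sub_right]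
    exact adj_idxB he hω hi₀ hl
  · simp only [Set.mem_setOf_eq] at ha hb
    simp only [rerootB, min_eq_left ha, min_eq_left hb, sub_left_inj] at hab
    have h1 : idxB m i₀ a ≤ m := by unfold idxB; split_ifs <;> omega
    have h2 : idxB m i₀ b ≤ m := by unfold idxB; split_ifs <;> omega
    have := hinj h1 h2 hab
    unfold idxB at this; split_ifs at this <;> omega

/-! ### The extreme root: a half-space piece ending at some `τ e_j`, `j ≠ k` -/

open Classical in
/-- **The extreme root.** For a sign `s`, a coordinate `k` and `m ≥ 2`, every `m`-step self-avoiding walk `ω : 0 → e` (`e ~ 0`)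
has a root `i₀ ≤ m` and a direction `τ e_j`, `j ≠ k`, such that one of the two re-rooted readings of the loop `ω ∪ {e, 0}` is an
`m`-step self-avoiding walk `0 → τ e_j` in the half-space `{s y_k ≥ 0}` (root = a vertex extreme in direction `−s e_k`; its two
loop-neighbours are distinct, so one of them is not `a + s e_k`).
[cite: MadrasSlade1993, §3.2, eqs. (3.2.3)–(3.2.4) and Corollary 3.2.6 (proof: the re-rooted polygon lies in a half-space)] -/
theorem exists_root (he : (zdGraph d).Adj 0 e) (hω : ω ∈ sawFun d m e) (hm : 2 ≤ m) (k : Fin d) {s : ℤ}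
    (hs : s = 1 ∨ s = -1) :
    ∃ i₀, i₀ ≤ m ∧ ∃ j : Fin d, j ≠ k ∧ ∃ τ : ℤ, (τ = 1 ∨ τ = -1) ∧
      ((rerootF m i₀ ω ∈ sawFun d m (Pi.single j τ) ∧ ∀ l ≤ m, 0 ≤ s * rerootF m i₀ ω l k) ∨
       (rerootB m i₀ ω ∈ sawFun d m (Pi.single j τ) ∧ ∀ l ≤ m, 0 ≤ s * rerootB m i₀ ω l k)) := by
  obtain ⟨h0, hend, hadj, hinj⟩ := mem_sawFun.1 hω
  -- minimise `s y_k`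
  obtain ⟨i₀, hi₀r, hmin⟩ := Finset.exists_min_image (Finset.range (m + 1)) (fun i => s * ω i k) ⟨0, by simp⟩
  have hi₀ : i₀ ≤ m := Nat.le_of_lt_succ (Finset.mem_range.1 hi₀r)
  set a := ω i₀ with ha
  have hmink : ∀ i ≤ m, s * a k ≤ s * ω i k := fun i hi => hmin i (Finset.mem_range.2 (by omega))
  -- a loop-neighbour `b` of `a` is `a + s e_k` or `a + τ e_j` with `j ≠ k`
  have key : ∀ i ≤ m, (zdGraph d).Adj a (ω i) →
      ω i = a + Pi.single k s ∨ ∃ j : Fin d, j ≠ k ∧ ∃ τ : ℤ, (τ = 1 ∨ τ = -1) ∧ ω i = a + Pi.single j τ := by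
    intro i hi hadj'
    obtain ⟨l, hl⟩ := (zdGraph_adj_iff _ _).1 hadj'
    by_cases hlk : l = k
    · subst hlk
      left
      have h1 := hmink i hi
      rcases hl with hl | hl
      · have e1 : ω i l = a l + 1 := by rw [hl]; simp
        rcases hs with rfl | rfl
        · exact hl
        · exfalso; rw [e1] at h1; linarith
      · have e1 : a l = ω i l + 1 := by rw [hl]; simp
        rcases hs with rfl | rfl
        · exfalso; rw [e1] at h1; linarith
        · rw [eq_sub_of_add_eq hl.symm, sub_eq_add_neg, ← Pi.single_neg]
    · right
      rcases hl with hl | hl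
      · exact ⟨l, hlk, 1, Or.inl rfl, hl⟩
      · exact ⟨l, hlk, -1, Or.inr rfl, by rw [eq_sub_of_add_eq hl.symm, sub_eq_add_neg, ← Pi.single_neg]⟩
  -- the two loop-neighbours of `a`: predecessor `ω (idxF m i₀ m)` and successor `ω (idxB m i₀ m)`
  have hidxF : idxF m i₀ m ≤ m := by unfold idxF; split_ifs <;> omega
  have hidxB : idxB m i₀ m ≤ m := by unfold idxB; split_ifs <;> omega
  have hpred_adj : (zdGraph d).Adj a (ω (idxF m i₀ m)) := by
    have h' := adj_idxB he hω hi₀ (l := 0) (by omega)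
    have e0 : idxB m i₀ 0 = i₀ := by unfold idxB; simp
    have e1 : idxB m i₀ (0 + 1) = idxF m i₀ m := by unfold idxB idxF; split_ifs <;> omega
    rwa [e0, e1] at h'
  have hsucc_adj : (zdGraph d).Adj a (ω (idxB m i₀ m)) := by
    have h' := adj_idxF he hω hi₀ (l := 0) (by omega)
    have e0 : idxF m i₀ 0 = i₀ := by unfold idxF; simp [hi₀]
    have e1 : idxF m i₀ (0 + 1) = idxB m i₀ m := by unfold idxB idxF; split_ifs <;> omega
    rwa [e0, e1] at h'
  have hne : ω (idxF m i₀ m) ≠ ω (idxB m i₀ m) := by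
    intro h
    have := hinj hidxF hidxB h
    unfold idxF idxB at this; split_ifs at this <;> omega
  have hcons : ∀ i ≤ m, 0 ≤ s * (ω i - a) k := by
    intro i hi
    have := hmink i hi
    simp only [Pi.sub_apply, mul_sub]; linarith
  refine ⟨i₀, hi₀, ?_⟩
  rcases key _ hidxF hpred_adj with hp | ⟨j, hj, τ, hτ, hp⟩
  · -- predecessor is `a + s e_k`, so the successor is some `a + τ e_j`: read backward
    rcases key _ hidxB hsucc_adj with hq | ⟨j, hj, τ, hτ, hq⟩
    · exact absurd (hp.trans hq.symm) hne
    · refine ⟨j, hj, τ, hτ, Or.inr ⟨?_, fun l hl => ?_⟩⟩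
      · have := rerootB_mem_sawFun he hω hi₀
        rwa [hq, ha, add_sub_cancel_left] at this
      · simp only [rerootB]
        exact hcons _ (by unfold idxB; split_ifs <;> omega)
  · -- predecessor is `a + τ e_j`: read forward
    refine ⟨j, hj, τ, hτ, Or.inl ⟨?_, fun l hl => ?_⟩⟩
    · have := rerootF_mem_sawFun he hω hi₀
      rwa [hp, ha, add_sub_cancel_left] at this
    · simp only [rerootF]
      exact hcons _ (by unfold idxF; split_ifs <;> omega)

/-! ### Counting -/

/-- The directions `τ e_j`, `j ≠ k`, `τ = ±1`. [folklore] -/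
def dirs (d : ℕ) (k : Fin d) : Finset (Fin d × ℤ) := (Finset.univ.erase k) ×ˢ ({1, -1} : Finset ℤ)

/-- Membership in `dirs`. [cite: MadrasSlade1993, §1.1 (the 2d nearest-neighbour steps ±e_j of ℤ^d)] -/
theorem mem_dirs {d : ℕ} {k : Fin d} {p : Fin d × ℤ} : p ∈ dirs d k ↔ p.1 ≠ k ∧ (p.2 = 1 ∨ p.2 = -1) := by
  rw [dirs, Finset.mem_product, Finset.mem_erase]
  simp only [Finset.mem_univ, and_true, Finset.mem_insert, Finset.mem_singleton]

/-- `#dirs ≤ 2 d`. [cite: MadrasSlade1993, §1.1 (the 2d nearest-neighbour steps ±e_j of ℤ^d)] -/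
theorem card_dirs_le (d : ℕ) (k : Fin d) : (dirs d k).card ≤ 2 * d := by
  rw [dirs, Finset.card_product]
  have h2 : ({1, -1} : Finset ℤ).card = 2 := by simp
  rw [h2]
  have := Finset.card_erase_le (s := (Finset.univ : Finset (Fin d))) (a := k)
  rw [Finset.card_univ, Fintype.card_fin] at this
  omega

open Classical in
/-- **Half-space pieces are at least as numerous as walks closing next to the origin, up to the factor `2(m+1)`**: for `m ≥ 2`,
a sign `s`, a coordinate `k` and a neighbour `e` of the origin,
`c_m(0,e) ≤ 2 (m+1) · Σ_{j ≠ k, τ = ±1} #{η ∈ sawFun d m (τ e_j) : ∀ i ≤ m, 0 ≤ s η(i)_k}`.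
[cite: MadrasSlade1993, §3.2, eqs. (3.2.1), (3.2.3)–(3.2.4); Corollary 3.2.6 (proof)] -/
theorem countAt_le_sum_card_halfSpace {m : ℕ} (he : (zdGraph d).Adj 0 e) (hm : 2 ≤ m) (k : Fin d) {s : ℤ}
    (hs : s = 1 ∨ s = -1) :
    countAt d m e ≤ 2 * (m + 1) *
      ∑ p ∈ dirs d k, ((sawFun d m (Pi.single p.1 p.2)).filter fun η => ∀ i ≤ m, 0 ≤ s * η i k).card := by
  set P : Fin d × ℤ → Finset (ℕ → Site d) := fun p =>
    (sawFun d m (Pi.single p.1 p.2)).filter fun η => ∀ i ≤ m, 0 ≤ s * η i k with hP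
  set CF : ℕ → Fin d × ℤ → Finset (ℕ → Site d) := fun i₀ p => (sawFun d m e).filter fun ω => rerootF m i₀ ω ∈ P p with hCF
  set CB : ℕ → Fin d × ℤ → Finset (ℕ → Site d) := fun i₀ p => (sawFun d m e).filter fun ω => rerootB m i₀ ω ∈ P p with hCB
  have hcover : sawFun d m e ⊆
      (Finset.range (m + 1)).biUnion fun i₀ => (dirs d k).biUnion fun p => CF i₀ p ∪ CB i₀ p := by
    intro ω hω
    obtain ⟨i₀, hi₀, j, hj, τ, hτ, h⟩ := exists_root he hω hm k hs
    rw [Finset.mem_biUnion]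
    refine ⟨i₀, Finset.mem_range.2 (by omega), ?_⟩
    rw [Finset.mem_biUnion]
    refine ⟨(j, τ), mem_dirs.2 ⟨hj, hτ⟩, ?_⟩
    rw [Finset.mem_union]
    rcases h with h | h
    · exact Or.inl (Finset.mem_filter.2 ⟨hω, Finset.mem_filter.2 h⟩)
    · exact Or.inr (Finset.mem_filter.2 ⟨hω, Finset.mem_filter.2 h⟩)
  have hF : ∀ i₀ ∈ Finset.range (m + 1), ∀ p, (CF i₀ p).card ≤ (P p).card := by
    intro i₀ hi₀ p
    have hi₀' : i₀ ≤ m := Nat.le_of_lt_succ (Finset.mem_range.1 hi₀)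
    refine Finset.card_le_card_of_injOn (rerootF m i₀) (fun ω hω => ?_) ?_
    · rw [Finset.mem_coe, hCF, Finset.mem_filter] at hω; exact hω.2
    · intro ω₁ h₁ ω₂ h₂ h
      rw [Finset.mem_coe, hCF, Finset.mem_filter] at h₁ h₂
      rw [← unrootF_rerootF h₁.1 hi₀', h, unrootF_rerootF h₂.1 hi₀']
  have hB : ∀ i₀ ∈ Finset.range (m + 1), ∀ p, (CB i₀ p).card ≤ (P p).card := by
    intro i₀ hi₀ p
    have hi₀' : i₀ ≤ m := Nat.le_of_lt_succ (Finset.mem_range.1 hi₀)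
    refine Finset.card_le_card_of_injOn (rerootB m i₀) (fun ω hω => ?_) ?_
    · rw [Finset.mem_coe, hCB, Finset.mem_filter] at hω; exact hω.2
    · intro ω₁ h₁ ω₂ h₂ h
      rw [Finset.mem_coe, hCB, Finset.mem_filter] at h₁ h₂
      rw [← unrootB_rerootB h₁.1 hi₀', h, unrootB_rerootB h₂.1 hi₀']
  rw [← card_sawFun]
  calc (sawFun d m e).card
      ≤ ((Finset.range (m + 1)).biUnion fun i₀ => (dirs d k).biUnion fun p => CF i₀ p ∪ CB i₀ p).card :=
        Finset.card_le_card hcover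
    _ ≤ ∑ i₀ ∈ Finset.range (m + 1), ((dirs d k).biUnion fun p => CF i₀ p ∪ CB i₀ p).card := Finset.card_biUnion_le
    _ ≤ ∑ i₀ ∈ Finset.range (m + 1), ∑ p ∈ dirs d k, (CF i₀ p ∪ CB i₀ p).card :=
        Finset.sum_le_sum fun i₀ _ => Finset.card_biUnion_le
    _ ≤ ∑ i₀ ∈ Finset.range (m + 1), ∑ p ∈ dirs d k, ((P p).card + (P p).card) :=
        Finset.sum_le_sum fun i₀ hi₀ => Finset.sum_le_sum fun p _ =>
          (Finset.card_union_le _ _).trans (Nat.add_le_add (hF i₀ hi₀ p) (hB i₀ hi₀ p))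
    _ = 2 * (m + 1) * ∑ p ∈ dirs d k, (P p).card := by
        rw [Finset.sum_const, Finset.card_range, smul_eq_mul]
        rw [show (∑ p ∈ dirs d k, ((P p).card + (P p).card)) = 2 * ∑ p ∈ dirs d k, (P p).card by
          rw [Finset.mul_sum]; exact Finset.sum_congr rfl fun p _ => by ring]
        ring

end HalfSpacePieces

end Literature.Probability.RandomPlanarGeometry.SAW.Zd
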